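import Summits.QuantumFields.YangMills.Theorems.BalabanUVNodesN21PartialDilationHazard

/-!
# N21 (NE7c) · SANITY for the dilation road (parts 16, 18): the hypotheses are jointly inhabited by a non-degenerate
# witness — the Gaussian weight on `ℝ^ι` with the CUBE statistic `‖x‖_∞`, with and without a star-shaped cut

R134 seat pub-ymgap-dag-n21-d (g8), node N21 = NE7c (single-run shell-weight bound, NOT PRINTED in [Bałaban 1983–89],
NOT proved), lane K3⁷ `SpineGivenEndpointR13SepCoPH` (stmt-QuantumFields-20544, `--kind proof --supports … --as helper`).
Part 22 of the comparison series (A2 guard for parts 16 and 18).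

WHAT THIS FILE IS.  Non-vacuity of the dilation road's binders on a concrete law: `A(x) = Σ_i x_i²∕2` (the standard
Gaussian weight `e^{−A}` on `ℝ^ι`), `U(x) = ‖x‖` (the sup norm of `ι → ℝ` = the cube statistic `max_i |x_i|` — the
shape of a block-sup of plaquette variables), `θ > 0`, `0 < ρ < 1`:
* `norm_smul_pos` ∕ `quadratic_radialMono`: `U` is exactly 1-homogeneous and `A(λx) = λ²A(x) ≤ A(x)` for
  `0 ≤ λ ≤ 1` — part 16's `hU`, `hmono` hold for EVERY shell;
* ★ `slotAntiConcentration_supNorm_gaussianWeight`: part 16's conclusion on this law —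
  `SlotAntiConcentration (ν|{‖x‖<θ}) ‖·‖ θ ρ (3(d+1)∕(1−ρ))`, `d = card ι` (compare part 2's `(√(2 log n)+4)·θ` for the
  max of `n` iid standard Gaussians: a different, n-dependent constant — the dilation constant pays the dimension, not
  the threshold);
* ★ `slotAntiConcentration_supNorm_gaussianWeight_cut`: part 18's conclusion with a STAR-SHAPED CUT riding in the
  density, `g = e^{−A}·𝟙_{‖x‖ ≤ R}` (block `b = univ`): the collar∕non-collapse hypothesis holds because a ball is
  star-shaped — cuts of homogeneous statistics ride along, as parts 16∕18 claim.

HONEST FRAMING.  [textbook]; a sanity witness, not an estimate on Bałaban's measure; 0 def, 0 sorry; NE7c NOT PRINTED ∕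
NOT proved; N21 NOT discharged; counts unmoved (typed 28∕28 · discharged 5∕27); count-neutral; one finite 𝕋⁴ at fixed
ε — nothing about ℝ⁴ ∕ OS ∕ mass gap ∕ Clay.
-/

open MeasureTheory Set Function
open scoped ENNReal NNReal

namespace Summit.QuantumFields.YangMills.Theorems.N21DilationHazardSanity

open Literature.MathematicalPhysics.QuantumFieldTheory.Balaban1983to89.T4ShellMeasure (SlotAntiConcentration)
open Summit.QuantumFields.YangMills.Theorems.N21DilationHazard (slotAntiConcentration_restrict_of_homogeneous)
open Summit.QuantumFields.YangMills.Theorems.N21PartialDilationHazard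
  (slotAntiConcentration_restrict_of_blockHomogeneous)

variable {ι : Type*} [Fintype ι]

/-- the sup norm of `ι → ℝ` is exactly 1-homogeneous under positive dilations. [textbook] -/
theorem norm_smul_pos {c : ℝ} (hc : 0 < c) (x : ι → ℝ) : ‖c • x‖ = c * ‖x‖ := by
  rw [norm_smul, Real.norm_eq_abs, abs_of_pos hc]

/-- the quadratic action `Σ x_i²∕2` is radially nondecreasing: `A(λx) = λ²·A(x) ≤ A(x)` for `0 ≤ λ ≤ 1`. [textbook] -/
theorem quadratic_radialMono {l : ℝ} (hl0 : 0 ≤ l) (hl1 : l ≤ 1) (x : ι → ℝ) :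
    ∑ i, (l • x) i ^ 2 / 2 ≤ ∑ i, x i ^ 2 / 2 := by
  refine Finset.sum_le_sum fun i _ => ?_
  have h1 : (l • x) i = l * x i := by simp [Pi.smul_apply, smul_eq_mul]
  rw [h1, mul_pow]
  have hl2 : l ^ 2 ≤ 1 := by nlinarith
  have hx : 0 ≤ x i ^ 2 := sq_nonneg _
  have : l ^ 2 * x i ^ 2 ≤ 1 * x i ^ 2 := mul_le_mul_of_nonneg_right hl2 hx
  linarith

/-- the quadratic action is measurable. [textbook] -/
theorem measurable_quadratic : Measurable fun x : ι → ℝ => ∑ i, x i ^ 2 / 2 :=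
  Finset.measurable_sum _ fun i _ => ((measurable_pi_apply i).pow_const 2).div_const 2

/-- ★ **SANITY FOR PART 16**: the Gaussian weight and the cube statistic `‖x‖_∞` inhabit
`slotAntiConcentration_restrict_of_homogeneous` for EVERY `θ > 0`, `0 < ρ < 1`:
`SlotAntiConcentration (ν|{‖x‖ < θ}) ‖·‖ θ ρ (3(d+1)∕(1−ρ))`. [textbook] -/
theorem slotAntiConcentration_supNorm_gaussianWeight [Nonempty ι] {θ ρ : ℝ} (hθ : 0 < θ) (hρ0 : 0 < ρ)
    (hρ1 : ρ < 1) :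
    SlotAntiConcentration
      ((volume.withDensity fun x : ι → ℝ => ENNReal.ofReal (Real.exp (-(∑ i, x i ^ 2 / 2)))).restrict
        {x | ‖x‖ < θ})
      (fun x => ‖x‖) θ ρ (3 * ((Fintype.card ι : ℝ) + 1) / (1 - ρ)) :=
  slotAntiConcentration_restrict_of_homogeneous measurable_quadratic continuous_norm.measurable
    (fun c hc x => norm_smul_pos hc x) hθ hρ0 hρ1
    (fun l hl x _ _ => quadratic_radialMono (by
      have : 1 / ((Fintype.card ι : ℝ) + 1) ≤ 1 := by
        rw [div_le_one (by positivity)]; linarith [show (0:ℝ) ≤ Fintype.card ι from Nat.cast_nonneg _]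
      linarith [hl.1]) hl.2 x)

/-- the full-block partial dilation is the dilation. [textbook] -/
theorem partialDil_univ [DecidableEq ι] (c : ℝ) (x : ι → ℝ) :
    (fun i => (if i ∈ (Finset.univ : Finset ι) then c else 1) * x i) = c • x := by
  funext i
  simp [Finset.mem_univ, Pi.smul_apply, smul_eq_mul]

/-- ★ **SANITY FOR PART 18 (a cut riding along)**: the Gaussian weight TIMES THE STAR-SHAPED CUT `𝟙_{‖x‖ ≤ R}` and the
cube statistic inhabit `slotAntiConcentration_restrict_of_blockHomogeneous` (block `= univ`) for every `θ > 0`,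
`0 < ρ < 1`, `R`: the block-radial non-collapse hypothesis holds because the action is radially nondecreasing AND the
ball is star-shaped. [textbook] -/
theorem slotAntiConcentration_supNorm_gaussianWeight_cut [DecidableEq ι] [Nonempty ι] {θ ρ : ℝ} (R : ℝ)
    (hθ : 0 < θ) (hρ0 : 0 < ρ) (hρ1 : ρ < 1) :
    SlotAntiConcentration
      ((volume.withDensity fun x : ι → ℝ =>
          ENNReal.ofReal (Real.exp (-(∑ i, x i ^ 2 / 2))) * {x | ‖x‖ ≤ R}.indicator 1 x).restrict {x | ‖x‖ < θ})
      (fun x => ‖x‖) θ ρ (3 * (((Finset.univ : Finset ι).card : ℝ) + 1) / (1 - ρ)) := by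
  have hg : Measurable fun x : ι → ℝ =>
      ENNReal.ofReal (Real.exp (-(∑ i, x i ^ 2 / 2))) * {x | ‖x‖ ≤ R}.indicator 1 x :=
    (ENNReal.measurable_ofReal.comp (Real.measurable_exp.comp measurable_quadratic.neg)).mul
      (measurable_one.indicator (measurableSet_le continuous_norm.measurable measurable_const))
  refine slotAntiConcentration_restrict_of_blockHomogeneous hg continuous_norm.measurable
    Finset.univ_nonempty (fun c hc x => ?_) hθ hρ0 hρ1 (fun l hl x _ _ => ?_)
  · rw [partialDil_univ, norm_smul_pos hc]
  · have hd : (0 : ℝ) ≤ ((Finset.univ : Finset ι).card : ℝ) := Nat.cast_nonneg _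
    have hl0 : 0 ≤ l := by
      have : 1 / (((Finset.univ : Finset ι).card : ℝ) + 1) ≤ 1 := by
        rw [div_le_one (by positivity)]; linarith
      linarith [hl.1]
    rw [partialDil_univ]
    refine mul_le_mul' (ENNReal.ofReal_le_ofReal (Real.exp_le_exp.2 ?_)) ?_
    · linarith [quadratic_radialMono hl0 hl.2 x]
    · -- the ball is star-shaped: `‖l • x‖ = l‖x‖ ≤ ‖x‖`
      by_cases hx : x ∈ {x : ι → ℝ | ‖x‖ ≤ R}
      · have hlx : l • x ∈ {x : ι → ℝ | ‖x‖ ≤ R} := by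
          simp only [mem_setOf_eq] at hx ⊢
          rw [norm_smul, Real.norm_eq_abs, abs_of_nonneg hl0]
          calc l * ‖x‖ ≤ 1 * ‖x‖ := mul_le_mul_of_nonneg_right hl.2 (norm_nonneg _)
            _ = ‖x‖ := one_mul _
            _ ≤ R := hx
        rw [indicator_of_mem hx, indicator_of_mem hlx, Pi.one_apply, Pi.one_apply]
      · rw [indicator_of_notMem hx]
        exact bot_le

end Summit.QuantumFields.YangMills.Theorems.N21DilationHazardSanity
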